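import Summits.AnomalousDissipation.AnomalousDissipation.Theses.KolmogorovLiouville

/-!
# Crux `SubBallisticLiouville` (stmt-AnomalousDissipation-3018) — strategist census, typed companion

Companion file of `STRATEGY-CENSUS.md` (crux-strategist seat `cstrat-stmt-AnomalousDissipation-3018-s1`).
It TYPES the objects the census talks about and kernel-checks the cheap structural facts the
census leans on; it proves nothing about Navier–Stokes.

* `InEternalClass`, `Growth`, `SliceConst` — the three blocks of the crux, verbatim; `crux_iff`
  (definitional unfolding of the route decl `…KolmogorovLiouville.SubBallisticLiouville`).
* `growth_mono`, `crux_iff_tail` — the crux is MONOTONE in the exponent `h` and is equivalent to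
  its restriction to any tail `h₀ ≤ h < 1`: no decomposition BY REGIME OF `h` can split it.
* `LocalBoundedness`, `BoundedOscLiouville`, `crux_of_split` — the best typed 2-piece split
  (regularity piece + Liouville-under-pointwise-bounds piece), seam proved; it is the cut of the
  live skeleton `Lines/birth.lean` (stub 1 | stubs 2∘3), recorded, NOT filed (see census).
* `StokesDominatedLiouville`, `stokesDominated_of_crux` — the perturbative tail `h < -1`
  (recommended SUPPORT item; the easy direction only).
* `NoSpontaneousStirring`, `noSpontaneousStirring_of_crux` — the uniqueness-type statement the
  crux contains (cheapest NEGATION target: a wild energy-class solution from rest refutes the crux).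
* `EternalStokesLiouville` — the solved linear sibling in the crux's own very-weak class
  (Jia–Seregin–Šverák 2012 Thm 1, growth form): the TRANSFER source.
* `AncientSubBallisticLiouville` — STRENGTHEN attempt 1 (backward-only version).
* `crux_trivialRegime` / `sliceConst_of_growth_lt` — the crux PROVED in the trivial regime `h < -3/2`
  (no PDE: the growth bound tends to `0` along integer radii and dominates the oscillation on every
  fixed ball; double-integral constancy argument `ae_eq_const_on_ball_of_osc`, globalised by
  `ae_eq_const_of_osc`). Kernel-checked special case: the plumbing of the statement computes.
-/

set_option linter.dupNamespace false

noncomputable section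

open MeasureTheory TopologicalSpace Set Filter Topology
open scoped ENNReal NNReal

namespace Summit.AnomalousDissipation.AnomalousDissipation.Cruxes.SubBallisticLiouville.Strategist

local notation "ℝ³" => EuclideanSpace ℝ (Fin 3)

/-- The eternal pressure-free energy class of the crux (its five clauses, verbatim): a.e.-strongly
measurable; `L^∞_t L²_x` on every `B_R × [-R², R²]`; weakly divergence-free slices a.e.; a weak
spatial gradient in `L²_loc`; the pressure-free weak form of unforced unit-viscosity Navier–Stokes
against smooth compactly supported divergence-free space–time tests. [folklore] -/
def InEternalClass (v : ℝ → ℝ³ → ℝ³) : Prop :=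
  MeasureTheory.AEStronglyMeasurable (Function.uncurry v) MeasureTheory.volume ∧
  (∀ R : ℝ, 0 < R → ∃ C : NNReal, ∀ᵐ t : ℝ, t ∈ Set.Icc (-R ^ 2) (R ^ 2) →
      ∫⁻ x in Metric.ball (0 : ℝ³) R, ‖v t x‖ₑ ^ 2 ≤ C) ∧
  (∀ᵐ t : ℝ, Literature.Analysis.FluidPDE.IsWeaklyDivFree (v t)) ∧
  (∃ G : ℝ → ℝ³ → ℝ³ →L[ℝ] ℝ³,
      Literature.Analysis.FluidPDE.HasWeakSpatialGradientOn
        (Literature.Analysis.FluidPDE.slab ℝ³ Set.univ isOpen_univ) v G ∧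
      ∀ R : ℝ, 0 < R → ∫⁻ z in Set.Icc (-R ^ 2) (R ^ 2) ×ˢ Metric.ball (0 : ℝ³) R,
        ENNReal.ofReal (Literature.Analysis.FluidPDE.frobeniusNormSq (G z.1 z.2)) < ⊤) ∧
  (∀ ψ : ℝ → ℝ³ → ℝ³,
      Literature.Analysis.FluidPDE.IsSpaceTimeTestOn
        (Literature.Analysis.FluidPDE.slab ℝ³ Set.univ isOpen_univ) ψ →
      (∀ t, Literature.Analysis.FluidPDE.VectorCalculus.IsDivFree (ψ t)) →
      ∫ t, ∫ x, (inner ℝ (v t x) (Literature.Analysis.FluidPDE.timeDeriv ψ t x) +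
        inner ℝ (v t x) (Literature.Analysis.FluidPDE.convect (v t) (ψ t) x) +
        inner ℝ (v t x) (Laplacian.laplacian (ψ t) x)) = 0)

/-- The sub-ballistic `L²`-oscillation growth clause of the crux with exponent `h` and constant `M`:
`∫_{B_R} |v(t) − ⨍_{B_R} v(t)|² ≤ M R^{3+2h}` for a.e. `|t| ≤ R²`, all `R ≥ 1`. [folklore] -/
def Growth (h M : ℝ) (v : ℝ → ℝ³ → ℝ³) : Prop :=
  ∀ R : ℝ, 1 ≤ R → ∀ᵐ t : ℝ, t ∈ Set.Icc (-R ^ 2) (R ^ 2) →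
    ∫⁻ x in Metric.ball (0 : ℝ³) R, ‖v t x - ⨍ y in Metric.ball (0 : ℝ³) R, v t y‖ₑ ^ 2
      ≤ ENNReal.ofReal (M * R ^ (3 + 2 * h))

/-- The conclusion of the crux: spatial constancy of a.e. time slice. [folklore] -/
def SliceConst (v : ℝ → ℝ³ → ℝ³) : Prop :=
  ∀ᵐ t : ℝ, ∃ b : ℝ³, ∀ᵐ x : ℝ³, v t x = b

/-- The route decl, unfolded into the three blocks (definitional). [folklore] -/
theorem crux_iff :
    Summit.AnomalousDissipation.AnomalousDissipation.Theses.KolmogorovLiouville.SubBallisticLiouville ↔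
      ∀ (h M : ℝ), h < 1 → ∀ v : ℝ → ℝ³ → ℝ³, InEternalClass v → Growth h M v → SliceConst v :=
  Iff.rfl

/-! ## Monotonicity in the exponent: no regime split -/

/-- **The growth clause is monotone in `h`** (`R ≥ 1`): `Growth h M v → Growth h' M v` for `h ≤ h'`.
For `M < 0` both bounds are the zero extended real. [folklore] -/
theorem growth_mono {h h' M : ℝ} (hle : h ≤ h') {v : ℝ → ℝ³ → ℝ³} (hg : Growth h M v) :
    Growth h' M v := by
  intro R hR
  rcases le_or_gt 0 M with hM | hM
  · filter_upwards [hg R hR] with t ht htI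
    exact (ht htI).trans (ENNReal.ofReal_le_ofReal
      (mul_le_mul_of_nonneg_left (Real.rpow_le_rpow_of_exponent_le hR (by linarith)) hM))
  · filter_upwards [hg R hR] with t ht htI
    refine (ht htI).trans ?_
    have h0 : M * R ^ (3 + 2 * h) ≤ 0 :=
      mul_nonpos_iff.2 (Or.inr ⟨hM.le, Real.rpow_nonneg (by linarith) _⟩)
    rw [ENNReal.ofReal_of_nonpos h0]
    exact bot_le

/-- **The crux equals each of its tails.** For every `h₀ < 1`, `SubBallisticLiouville` is equivalent
to its restriction to exponents `h₀ ≤ h < 1`; in particular all of its difficulty sits at `h → 1⁻`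
and a decomposition by ranges of `h` has one piece equal to the whole crux. [folklore] -/
theorem crux_iff_tail (h₀ : ℝ) (hh₀ : h₀ < 1) :
    Summit.AnomalousDissipation.AnomalousDissipation.Theses.KolmogorovLiouville.SubBallisticLiouville ↔
      ∀ (h M : ℝ), h₀ ≤ h → h < 1 → ∀ v : ℝ → ℝ³ → ℝ³,
        InEternalClass v → Growth h M v → SliceConst v := by
  rw [crux_iff]
  constructor
  · intro H h M _ hh v hv hg
    exact H h M hh v hv hg
  · intro H h M hh v hv hg
    exact H (max h h₀) M (le_max_right _ _) (max_lt hh hh₀) v hv (growth_mono (le_max_left _ _) hg)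

/-! ## The best typed split (recorded, not filed) -/

/-- Pointwise sub-ballistic oscillation with exponent `h'` and constant `C` (the output of the live
skeleton's `stub_localBoundedness`). [folklore] -/
def PointwiseOsc (h' C : ℝ) (v : ℝ → ℝ³ → ℝ³) : Prop :=
  ∀ R : ℝ, 1 ≤ R → ∀ᵐ t : ℝ, t ∈ Set.Icc (-R ^ 2) (R ^ 2) → ∀ᵐ x : ℝ³,
    x ∈ Metric.ball (0 : ℝ³) R → ‖v t x - ⨍ y in Metric.ball (0 : ℝ³) R, v t y‖ ≤ C * R ^ h'

/-- Split piece 1 (REGULARITY): integral sub-ballistic growth of an eternal energy-class solution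
upgrades to pointwise sub-ballistic oscillation for some exponent `h' < 1` — the statement of the
registered `stub_localBoundedness`. [folklore] -/
def LocalBoundedness : Prop :=
  ∀ (h M : ℝ), h < 1 → ∀ v : ℝ → ℝ³ → ℝ³, InEternalClass v → Growth h M v →
    ∃ h' : ℝ, h' < 1 ∧ ∃ C : ℝ, PointwiseOsc h' C v

/-- Split piece 2 (LIOUVILLE UNDER POINTWISE BOUNDS): the crux with the extra pointwise hypothesis —
the natural full-3-D analogue of Pan–Li 2020 Thm 1.1 / KNSS Thm 5.1–5.2 in the energy class; it still
contains the bounded eternal case of the KNSS conjecture (`h' = 0`) and Galdi's D-solution problem.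
[cite: KochNadirashviliSereginSverak2009, §1] -/
def BoundedOscLiouville : Prop :=
  ∀ (h M h' C : ℝ), h < 1 → h' < 1 → ∀ v : ℝ → ℝ³ → ℝ³,
    InEternalClass v → Growth h M v → PointwiseOsc h' C v → SliceConst v

/-- **Seam of the split** (modus ponens): `LocalBoundedness → BoundedOscLiouville → crux`. [folklore] -/
theorem crux_of_split :
    LocalBoundedness → BoundedOscLiouville →
      Summit.AnomalousDissipation.AnomalousDissipation.Theses.KolmogorovLiouville.SubBallisticLiouville := by
  intro h1 h2
  rw [crux_iff]
  intro h M hh v hv hg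
  obtain ⟨h', hh', C, hC⟩ := h1 h M hh v hv hg
  exact h2 h M h' C hh hh' v hv hg hC

/-! ## The perturbative tail `h < -1` (recommended support item) -/

/-- The STOKES-DOMINATED tail of the crux: exponents `h < -1`, where the NS blow-down
`v ↦ λ v(λ²·, λ·)` sends the growth constant `M` to `M λ^{2+2h} → 0` (large-scale Reynolds number
`R^{1+h} → 0`). Plausibly provable (caloric vorticity of the Stokes part + absolutely convergent
Duhamel term for `h < -1/2` + Kato smallness for `h < -1`); it is the EASY tail and does not give
the crux back (`crux_iff_tail` goes the other way). [folklore] -/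
def StokesDominatedLiouville : Prop :=
  ∀ (h M : ℝ), h < -1 → ∀ v : ℝ → ℝ³ → ℝ³, InEternalClass v → Growth h M v → SliceConst v

/-- The crux gives its Stokes-dominated tail (trivial direction). [folklore] -/
theorem stokesDominated_of_crux :
    Summit.AnomalousDissipation.AnomalousDissipation.Theses.KolmogorovLiouville.SubBallisticLiouville →
      StokesDominatedLiouville := by
  rw [crux_iff]
  intro H h M hh v hv hg
  exact H h M (by linarith) v hv hg

/-! ## The uniqueness statement inside the crux (negation target) -/

/-- **No spontaneous stirring** in the eternal energy class: a solution of the class with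
sub-ballistic growth which is spatially constant at a.e. NEGATIVE time is spatially constant at
a.e. time. The crux contains it; a wild (convex-integration-type) energy-class solution emanating
from a state of rest would refute it, hence the crux, with no turbulence involved. [folklore] -/
def NoSpontaneousStirring : Prop :=
  ∀ (h M : ℝ), h < 1 → ∀ v : ℝ → ℝ³ → ℝ³, InEternalClass v → Growth h M v →
    (∀ᵐ t : ℝ, t < 0 → ∃ b : ℝ³, ∀ᵐ x : ℝ³, v t x = b) → SliceConst v

/-- The crux implies no-spontaneous-stirring (drop the extra hypothesis). [folklore] -/
theorem noSpontaneousStirring_of_crux :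
    Summit.AnomalousDissipation.AnomalousDissipation.Theses.KolmogorovLiouville.SubBallisticLiouville →
      NoSpontaneousStirring := by
  rw [crux_iff]
  intro H h M hh v hv hg _
  exact H h M hh v hv hg

/-! ## The solved linear sibling (transfer source) -/

/-- The eternal very-weak STOKES class: the crux's class with the convective term deleted from the
weak form (Jia–Seregin–Šverák's very weak ancient solutions, two-sided in time, with growth instead
of boundedness). [cite: JiaSereginSverak2012, Def. 1 and Thm. 1] -/
def InEternalStokesClass (v : ℝ → ℝ³ → ℝ³) : Prop :=
  MeasureTheory.AEStronglyMeasurable (Function.uncurry v) MeasureTheory.volume ∧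
  (∀ R : ℝ, 0 < R → ∃ C : NNReal, ∀ᵐ t : ℝ, t ∈ Set.Icc (-R ^ 2) (R ^ 2) →
      ∫⁻ x in Metric.ball (0 : ℝ³) R, ‖v t x‖ₑ ^ 2 ≤ C) ∧
  (∀ᵐ t : ℝ, Literature.Analysis.FluidPDE.IsWeaklyDivFree (v t)) ∧
  (∃ G : ℝ → ℝ³ → ℝ³ →L[ℝ] ℝ³,
      Literature.Analysis.FluidPDE.HasWeakSpatialGradientOn
        (Literature.Analysis.FluidPDE.slab ℝ³ Set.univ isOpen_univ) v G ∧
      ∀ R : ℝ, 0 < R → ∫⁻ z in Set.Icc (-R ^ 2) (R ^ 2) ×ˢ Metric.ball (0 : ℝ³) R,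
        ENNReal.ofReal (Literature.Analysis.FluidPDE.frobeniusNormSq (G z.1 z.2)) < ⊤) ∧
  (∀ ψ : ℝ → ℝ³ → ℝ³,
      Literature.Analysis.FluidPDE.IsSpaceTimeTestOn
        (Literature.Analysis.FluidPDE.slab ℝ³ Set.univ isOpen_univ) ψ →
      (∀ t, Literature.Analysis.FluidPDE.VectorCalculus.IsDivFree (ψ t)) →
      ∫ t, ∫ x, (inner ℝ (v t x) (Literature.Analysis.FluidPDE.timeDeriv ψ t x) +
        inner ℝ (v t x) (Laplacian.laplacian (ψ t) x)) = 0)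

/-- **Eternal Stokes Liouville with sub-ballistic growth** (the solved sibling, growth form of
Jia–Seregin–Šverák 2012 Thm 1 for `Ω = ℝ³`): expected provable — the distributional vorticity is an
eternal caloric distribution whose `H⁻¹`-averaged size on `Q_R` is `O(R^{h-1}) → 0`, hence zero;
then the slice is weakly curl-free, weakly div-free with sub-ballistic growth, hence constant
(the live skeleton's `stub_annihilatorLiouvilleGrowth`). [cite: JiaSereginSverak2012, Thm. 1] -/
def EternalStokesLiouville : Prop :=
  ∀ (h M : ℝ), h < 1 → ∀ v : ℝ → ℝ³ → ℝ³, InEternalStokesClass v → Growth h M v → SliceConst v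

/-! ## Strengthen attempt 1: the ancient version -/

/-- The ANCIENT (backward-only) class: the clauses of the crux restricted to negative times
(slab `ℝ³ × (-∞, 0)`, windows `[-R², 0)`). [cite: KochNadirashviliSereginSverak2009, §1] -/
def InAncientClass (v : ℝ → ℝ³ → ℝ³) : Prop :=
  MeasureTheory.AEStronglyMeasurable (Function.uncurry v)
      ((MeasureTheory.volume.restrict (Set.Iio (0 : ℝ))).prod MeasureTheory.volume) ∧
  (∀ R : ℝ, 0 < R → ∃ C : NNReal, ∀ᵐ t : ℝ, t ∈ Set.Ico (-R ^ 2) 0 →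
      ∫⁻ x in Metric.ball (0 : ℝ³) R, ‖v t x‖ₑ ^ 2 ≤ C) ∧
  (∀ᵐ t : ℝ, t < 0 → Literature.Analysis.FluidPDE.IsWeaklyDivFree (v t)) ∧
  (∃ G : ℝ → ℝ³ → ℝ³ →L[ℝ] ℝ³,
      Literature.Analysis.FluidPDE.HasWeakSpatialGradientOn
        (Literature.Analysis.FluidPDE.slab ℝ³ (Set.Iio 0) isOpen_Iio) v G ∧
      ∀ R : ℝ, 0 < R → ∫⁻ z in Set.Ico (-R ^ 2) 0 ×ˢ Metric.ball (0 : ℝ³) R,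
        ENNReal.ofReal (Literature.Analysis.FluidPDE.frobeniusNormSq (G z.1 z.2)) < ⊤) ∧
  (∀ ψ : ℝ → ℝ³ → ℝ³,
      Literature.Analysis.FluidPDE.IsSpaceTimeTestOn
        (Literature.Analysis.FluidPDE.slab ℝ³ (Set.Iio 0) isOpen_Iio) ψ →
      (∀ t, Literature.Analysis.FluidPDE.VectorCalculus.IsDivFree (ψ t)) →
      ∫ t, ∫ x, (inner ℝ (v t x) (Literature.Analysis.FluidPDE.timeDeriv ψ t x) +
        inner ℝ (v t x) (Literature.Analysis.FluidPDE.convect (v t) (ψ t) x) +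
        inner ℝ (v t x) (Laplacian.laplacian (ψ t) x)) = 0)

/-- Backward-only growth clause. [folklore] -/
def AncientGrowth (h M : ℝ) (v : ℝ → ℝ³ → ℝ³) : Prop :=
  ∀ R : ℝ, 1 ≤ R → ∀ᵐ t : ℝ, t ∈ Set.Ico (-R ^ 2) 0 →
    ∫⁻ x in Metric.ball (0 : ℝ³) R, ‖v t x - ⨍ y in Metric.ball (0 : ℝ³) R, v t y‖ₑ ^ 2
      ≤ ENNReal.ofReal (M * R ^ (3 + 2 * h))

/-- **S⁺₁ — ancient sub-ballistic Liouville** (KNSS-with-growth in the energy class): STRONGER than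
the crux (an eternal solution is ancient, and time translation preserves class and growth up to
constants), and it contains the KNSS conjecture for bounded ancient very weak solutions outright;
the added generality (no forward half) buys no rigidity. [cite: KochNadirashviliSereginSverak2009, §1] -/
def AncientSubBallisticLiouville : Prop :=
  ∀ (h M : ℝ), h < 1 → ∀ v : ℝ → ℝ³ → ℝ³, InAncientClass v → AncientGrowth h M v →
    ∀ᵐ t : ℝ, t < 0 → ∃ b : ℝ³, ∀ᵐ x : ℝ³, v t x = b

/-! ## The trivial regime `h < -3/2` (kernel-checked special case of the crux)

For `3 + 2h < 0` the growth bound `∫_{B_n}|v(t) − ⨍_{B_n}v(t)|² ≤ M n^{3+2h}` tends to `0` along the integer radii,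
while its left side dominates the oscillation on every fixed smaller ball; no PDE is used. This certifies that the
crux's plumbing (`⨍` on balls, `∀ᵐ` windows, `ℝ≥0∞` bounds) computes, and records the exact point (`h = -3/2`) below
which the statement is empty of Navier–Stokes content. -/

section TrivialRegime

/-- `‖a − b‖ₑ² ≤ 2‖a − c‖ₑ² + 2‖b − c‖ₑ²` in `ℝ≥0∞`. [folklore] -/
theorem enorm_sub_sq_le (a b c : ℝ³) :
    ‖a - b‖ₑ ^ 2 ≤ 2 * ‖a - c‖ₑ ^ 2 + 2 * ‖b - c‖ₑ ^ 2 := by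
  have h1 : ‖a - b‖ ≤ ‖a - c‖ + ‖b - c‖ := by
    calc ‖a - b‖ = ‖(a - c) - (b - c)‖ := by congr 1; abel
      _ ≤ ‖a - c‖ + ‖b - c‖ := norm_sub_le _ _
  have h : ‖a - b‖ ^ 2 ≤ 2 * ‖a - c‖ ^ 2 + 2 * ‖b - c‖ ^ 2 := by
    nlinarith [norm_nonneg (a - b), norm_nonneg (a - c), norm_nonneg (b - c),
      sq_nonneg (‖a - c‖ - ‖b - c‖)]
  have e : ∀ x : ℝ³, ‖x‖ₑ ^ 2 = ENNReal.ofReal (‖x‖ ^ 2) := fun x => by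
    rw [← ofReal_norm, ENNReal.ofReal_pow (norm_nonneg _)]
  have h2 : (0:ℝ) ≤ 2 := by norm_num
  rw [e, e, e]
  calc ENNReal.ofReal (‖a - b‖ ^ 2) ≤ ENNReal.ofReal (2 * ‖a - c‖ ^ 2 + 2 * ‖b - c‖ ^ 2) :=
        ENNReal.ofReal_le_ofReal h
    _ = 2 * ENNReal.ofReal (‖a - c‖ ^ 2) + 2 * ENNReal.ofReal (‖b - c‖ ^ 2) := by
        rw [ENNReal.ofReal_add (by positivity) (by positivity), ENNReal.ofReal_mul h2,
          ENNReal.ofReal_mul h2, ENNReal.ofReal_ofNat]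

/-- **Vanishing oscillation on large balls forces constancy on each ball.** If `w` is strongly measurable and its
`L²`-oscillation about its own mean on `B_n` is `≤ ε n` for the integers `n ≥ n₀`, with `ε n → 0`, then `w` is a.e.
constant on every ball `B_r`. (Double-integral argument: `∬_{B_r×B_r} ‖w x − w y‖² ≤ 4 |B_r| ε n`.) [folklore] -/
theorem ae_eq_const_on_ball_of_osc {w : ℝ³ → ℝ³} (hw : StronglyMeasurable w) (ε : ℕ → ℝ≥0∞)
    (hε : Tendsto ε atTop (𝓝 0)) (n₀ : ℕ)
    (hosc : ∀ n : ℕ, n₀ ≤ n →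
      ∫⁻ x in Metric.ball (0 : ℝ³) n, ‖w x - ⨍ y in Metric.ball (0 : ℝ³) n, w y‖ₑ ^ 2 ≤ ε n)
    {r : ℝ} (hr : 0 < r) :
    ∃ b : ℝ³, ∀ᵐ x ∂(volume.restrict (Metric.ball (0 : ℝ³) r)), w x = b := by
  set V : ℝ≥0∞ := volume (Metric.ball (0 : ℝ³) r) with hV
  have hVtop : V ≠ ⊤ := measure_ball_lt_top.ne
  set I : ℝ≥0∞ := ∫⁻ x in Metric.ball (0 : ℝ³) r, ∫⁻ y in Metric.ball (0 : ℝ³) r, ‖w x - w y‖ₑ ^ 2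
    with hI
  -- the double integral is ≤ 4 V ε n for n ≥ max n₀ ⌈r⌉₊
  have hIle : ∀ n : ℕ, max n₀ ⌈r⌉₊ ≤ n → I ≤ 4 * V * ε n := by
    intro n hn
    have hn₀ : n₀ ≤ n := le_of_max_le_left hn
    have hrn : r ≤ n := (Nat.le_ceil r).trans (by exact_mod_cast le_of_max_le_right hn)
    set c : ℝ³ := ⨍ y in Metric.ball (0 : ℝ³) n, w y with hc
    have hsub : Metric.ball (0 : ℝ³) r ⊆ Metric.ball (0 : ℝ³) (n : ℝ) := Metric.ball_subset_ball hrn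
    have hεr : ∫⁻ x in Metric.ball (0 : ℝ³) r, ‖w x - c‖ₑ ^ 2 ≤ ε n :=
      (lintegral_mono_set hsub).trans (hosc n hn₀)
    have hinner : ∀ x, ∫⁻ y in Metric.ball (0 : ℝ³) r, ‖w x - w y‖ₑ ^ 2 ≤
        2 * V * ‖w x - c‖ₑ ^ 2 + 2 * ε n := by
      intro x
      calc ∫⁻ y in Metric.ball (0 : ℝ³) r, ‖w x - w y‖ₑ ^ 2
          ≤ ∫⁻ y in Metric.ball (0 : ℝ³) r, (2 * ‖w x - c‖ₑ ^ 2 + 2 * ‖w y - c‖ₑ ^ 2) :=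
            lintegral_mono fun y => enorm_sub_sq_le _ _ _
        _ = (∫⁻ _y in Metric.ball (0 : ℝ³) r, 2 * ‖w x - c‖ₑ ^ 2) +
              ∫⁻ y in Metric.ball (0 : ℝ³) r, 2 * ‖w y - c‖ₑ ^ 2 :=
            lintegral_add_left measurable_const _
        _ = 2 * V * ‖w x - c‖ₑ ^ 2 + 2 * ∫⁻ y in Metric.ball (0 : ℝ³) r, ‖w y - c‖ₑ ^ 2 := by
            rw [setLIntegral_const, lintegral_const_mul' _ _ ENNReal.ofNat_ne_top]
            ring
        _ ≤ 2 * V * ‖w x - c‖ₑ ^ 2 + 2 * ε n := by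
            gcongr
    calc I ≤ ∫⁻ x in Metric.ball (0 : ℝ³) r, (2 * V * ‖w x - c‖ₑ ^ 2 + 2 * ε n) := lintegral_mono hinner
      _ = (∫⁻ x in Metric.ball (0 : ℝ³) r, 2 * V * ‖w x - c‖ₑ ^ 2) +
            ∫⁻ _x in Metric.ball (0 : ℝ³) r, 2 * ε n := lintegral_add_right _ measurable_const
      _ = 2 * V * (∫⁻ x in Metric.ball (0 : ℝ³) r, ‖w x - c‖ₑ ^ 2) + 2 * ε n * V := by
            rw [setLIntegral_const, lintegral_const_mul' _ _ (ENNReal.mul_ne_top ENNReal.ofNat_ne_top hVtop)]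
      _ ≤ 2 * V * ε n + 2 * ε n * V := by gcongr
      _ = 4 * V * ε n := by ring
  -- hence it vanishes
  have hI0 : I = 0 := by
    refine le_antisymm ?_ bot_le
    have ht : Tendsto (fun n => 4 * V * ε n) atTop (𝓝 (4 * V * 0)) :=
      ENNReal.Tendsto.const_mul hε (Or.inr (ENNReal.mul_ne_top ENNReal.ofNat_ne_top hVtop))
    rw [mul_zero] at ht
    exact ge_of_tendsto ht (Filter.eventually_atTop.2 ⟨max n₀ ⌈r⌉₊, hIle⟩)
  -- measurability of the two integrands
  have h2 : Measurable fun p : ℝ³ × ℝ³ => ‖w p.1 - w p.2‖ₑ ^ 2 :=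
    ((hw.measurable.comp measurable_fst).sub (hw.measurable.comp measurable_snd)).enorm.pow_const 2
  have hmeasF : Measurable fun x => ∫⁻ y in Metric.ball (0 : ℝ³) r, ‖w x - w y‖ₑ ^ 2 :=
    h2.lintegral_prod_right'
  have hae : ∀ᵐ x ∂(volume.restrict (Metric.ball (0 : ℝ³) r)),
      ∫⁻ y in Metric.ball (0 : ℝ³) r, ‖w x - w y‖ₑ ^ 2 = 0 := by
    have := (lintegral_eq_zero_iff hmeasF).1 hI0
    filter_upwards [this] with x hx
    simpa using hx
  -- pick a good centre x₀
  haveI : (ae (volume.restrict (Metric.ball (0 : ℝ³) r))).NeBot := by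
    refine ae_neBot.2 ?_
    intro h0
    exact (Metric.measure_ball_pos volume (0 : ℝ³) hr).ne' (Measure.restrict_eq_zero.1 h0)
  obtain ⟨x₀, hx₀⟩ := hae.exists
  refine ⟨w x₀, ?_⟩
  have hmeas₀ : Measurable fun y => ‖w x₀ - w y‖ₑ ^ 2 :=
    (measurable_const.sub hw.measurable).enorm.pow_const 2
  have := (lintegral_eq_zero_iff hmeas₀).1 hx₀
  filter_upwards [this] with y hy
  have hy' : ‖w x₀ - w y‖ₑ ^ 2 = 0 := by simpa using hy
  have : ‖w x₀ - w y‖ₑ = 0 := by simpa using hy'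
  rw [enorm_eq_zero, sub_eq_zero] at this
  exact this.symm

/-- **Globalisation**: under the hypotheses of `ae_eq_const_on_ball_of_osc`, `w` is a.e. equal to one constant on
the whole space (the balls `B_{m+1}` exhaust `ℝ³` and all contain `B_1`, which has positive measure). [folklore] -/
theorem ae_eq_const_of_osc {w : ℝ³ → ℝ³} (hw : StronglyMeasurable w) (ε : ℕ → ℝ≥0∞)
    (hε : Tendsto ε atTop (𝓝 0)) (n₀ : ℕ)
    (hosc : ∀ n : ℕ, n₀ ≤ n →
      ∫⁻ x in Metric.ball (0 : ℝ³) n, ‖w x - ⨍ y in Metric.ball (0 : ℝ³) n, w y‖ₑ ^ 2 ≤ ε n) :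
    ∃ b : ℝ³, ∀ᵐ x, w x = b := by
  have hball : ∀ m : ℕ, ∃ b : ℝ³,
      ∀ᵐ x ∂(volume.restrict (Metric.ball (0 : ℝ³) ((m : ℝ) + 1))), w x = b :=
    fun m => ae_eq_const_on_ball_of_osc hw ε hε n₀ hosc (by positivity)
  choose b hb using hball
  have hb0 : ∀ m, b m = b 0 := by
    intro m
    have hsub : Metric.ball (0 : ℝ³) (((0 : ℕ) : ℝ) + 1) ⊆ Metric.ball (0 : ℝ³) ((m : ℝ) + 1) :=
      Metric.ball_subset_ball (by push_cast; linarith [(Nat.cast_nonneg m : (0 : ℝ) ≤ m)])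
    have h1 : ∀ᵐ x ∂(volume.restrict (Metric.ball (0 : ℝ³) (((0 : ℕ) : ℝ) + 1))), w x = b m :=
      ae_restrict_of_ae_restrict_of_subset hsub (hb m)
    haveI : (ae (volume.restrict (Metric.ball (0 : ℝ³) (((0 : ℕ) : ℝ) + 1)))).NeBot := by
      refine ae_neBot.2 ?_
      intro h0
      exact (Metric.measure_ball_pos volume (0 : ℝ³) (by norm_num : (0 : ℝ) < ((0 : ℕ) : ℝ) + 1)).ne'
        (Measure.restrict_eq_zero.1 h0)
    obtain ⟨x, hx1, hx0⟩ := (h1.and (hb 0)).exists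
    rw [← hx1, ← hx0]
  refine ⟨b 0, ?_⟩
  have hall : ∀ m : ℕ, ∀ᵐ x ∂(volume.restrict (Metric.ball (0 : ℝ³) ((m : ℝ) + 1))), w x = b 0 :=
    fun m => (hb m).mono fun x hx => hx.trans (hb0 m)
  have hU : (⋃ m : ℕ, Metric.ball (0 : ℝ³) ((m : ℝ) + 1)) = univ := by
    refine eq_univ_of_forall fun x => ?_
    simp only [mem_iUnion, Metric.mem_ball, dist_zero_right]
    exact ⟨⌈‖x‖⌉₊, by linarith [Nat.le_ceil ‖x‖]⟩
  have := (ae_restrict_iUnion_iff (μ := (volume : Measure ℝ³))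
    (s := fun m : ℕ => Metric.ball (0 : ℝ³) ((m : ℝ) + 1)) (p := fun x => w x = b 0)).2 hall
  rwa [hU, Measure.restrict_univ] at this

/-- **The crux in the trivial regime `h < -3/2`** (kernel-checked; no PDE content): the growth bound alone forces
spatial constancy of a.e. slice. [folklore] -/
theorem sliceConst_of_growth_lt (h M : ℝ) (hh : h < -3 / 2) (v : ℝ → ℝ³ → ℝ³)
    (hv : InEternalClass v) (hg : Growth h M v) : SliceConst v := by
  obtain ⟨hmeas, -, -, -, -⟩ := hv
  -- slices are a.e.-strongly measurable for a.e. t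
  have hslice : ∀ᵐ t : ℝ, MeasureTheory.AEStronglyMeasurable (v t) MeasureTheory.volume := by
    have hmeas' : MeasureTheory.AEStronglyMeasurable (Function.uncurry v)
        ((MeasureTheory.volume : Measure ℝ).prod (MeasureTheory.volume : Measure ℝ³)) := by
      simpa [MeasureTheory.Measure.volume_eq_prod] using hmeas
    simpa [Function.uncurry] using hmeas'.prodMk_left
  -- growth on B_n, all integer radii at once
  have hgn : ∀ n : ℕ, ∀ᵐ t : ℝ, (1 : ℝ) ≤ n → t ∈ Set.Icc (-(n : ℝ) ^ 2) ((n : ℝ) ^ 2) →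
      ∫⁻ x in Metric.ball (0 : ℝ³) (n : ℝ), ‖v t x - ⨍ y in Metric.ball (0 : ℝ³) (n : ℝ), v t y‖ₑ ^ 2
        ≤ ENNReal.ofReal (M * (n : ℝ) ^ (3 + 2 * h)) := by
    intro n
    by_cases hn : (1 : ℝ) ≤ n
    · filter_upwards [hg (n : ℝ) hn] with t ht _ htI
      exact ht htI
    · exact Filter.Eventually.of_forall fun t h1 => absurd h1 hn
  have hgall := MeasureTheory.ae_all_iff.2 hgn
  -- the bound tends to zero
  have htend : Tendsto (fun n : ℕ => ENNReal.ofReal (M * (n : ℝ) ^ (3 + 2 * h))) atTop (𝓝 0) := by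
    have h1 : Tendsto (fun n : ℕ => (n : ℝ) ^ (3 + 2 * h)) atTop (𝓝 0) := by
      have := (tendsto_rpow_neg_atTop (by linarith : 0 < -(3 + 2 * h))).comp tendsto_natCast_atTop_atTop
      simpa [neg_neg, Function.comp_def] using this
    have h2 := h1.const_mul M
    rw [mul_zero] at h2
    simpa using ENNReal.tendsto_ofReal h2
  filter_upwards [hslice, hgall] with t ht_meas ht_g
  -- a strongly measurable representative of the slice
  set w : ℝ³ → ℝ³ := ht_meas.mk (v t) with hwdef
  have hw : StronglyMeasurable w := ht_meas.stronglyMeasurable_mk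
  have hvw : v t =ᵐ[volume] w := ht_meas.ae_eq_mk
  set n₀ : ℕ := ⌈|t|⌉₊ + 1 with hn₀
  have hosc : ∀ n : ℕ, n₀ ≤ n →
      ∫⁻ x in Metric.ball (0 : ℝ³) n, ‖w x - ⨍ y in Metric.ball (0 : ℝ³) n, w y‖ₑ ^ 2
        ≤ ENNReal.ofReal (M * (n : ℝ) ^ (3 + 2 * h)) := by
    intro n hn
    have h1 : (1 : ℝ) ≤ n := by
      have : (1 : ℕ) ≤ n := le_trans (Nat.le_add_left 1 _) hn
      exact_mod_cast this
    have htI : t ∈ Set.Icc (-(n : ℝ) ^ 2) ((n : ℝ) ^ 2) := by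
      have hceil : |t| ≤ (⌈|t|⌉₊ : ℝ) := Nat.le_ceil _
      have hcast : ((⌈|t|⌉₊ + 1 : ℕ) : ℝ) ≤ (n : ℝ) := by exact_mod_cast hn
      have habs : |t| ≤ (n : ℝ) := by push_cast at hcast; linarith
      have hsq : (n : ℝ) ≤ (n : ℝ) ^ 2 := by nlinarith
      constructor
      · have := neg_abs_le t
        linarith
      · have := le_abs_self t
        linarith
    have hvw' : ∀ᵐ x ∂(volume.restrict (Metric.ball (0 : ℝ³) (n : ℝ))), v t x = w x :=
      ae_restrict_of_ae hvw
    have havg : ⨍ y in Metric.ball (0 : ℝ³) (n : ℝ), v t y = ⨍ y in Metric.ball (0 : ℝ³) (n : ℝ), w y :=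
      average_congr hvw'
    calc ∫⁻ x in Metric.ball (0 : ℝ³) n, ‖w x - ⨍ y in Metric.ball (0 : ℝ³) n, w y‖ₑ ^ 2
        = ∫⁻ x in Metric.ball (0 : ℝ³) n, ‖v t x - ⨍ y in Metric.ball (0 : ℝ³) n, v t y‖ₑ ^ 2 := by
          rw [havg]
          exact lintegral_congr_ae (hvw'.mono fun x hx => by simp only [hx])
      _ ≤ ENNReal.ofReal (M * (n : ℝ) ^ (3 + 2 * h)) := ht_g n h1 htI
  obtain ⟨b, hb⟩ := ae_eq_const_of_osc hw _ htend n₀ hosc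
  exact ⟨b, (hvw.and hb).mono fun x hx => hx.1.trans hx.2⟩

/-- The trivial regime, stated against the route decl's shape: `C` restricted to `h < -3/2` holds. [folklore] -/
theorem crux_trivialRegime :
    ∀ (h M : ℝ), h < -3 / 2 → ∀ v : ℝ → ℝ³ → ℝ³, InEternalClass v → Growth h M v → SliceConst v :=
  fun h M hh v hv hg => sliceConst_of_growth_lt h M hh v hv hg

end TrivialRegime

end Summit.AnomalousDissipation.AnomalousDissipation.Cruxes.SubBallisticLiouville.Strategist

end
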